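import Literature.MathematicalPhysics.QuantumFieldTheory.ConstructiveQFTWave0Proofs
import Literature.MathematicalPhysics.QuantumFieldTheory.StrongCouplingActivities
import Mathlib.MeasureTheory.Integral.Prod
import HarnessLib

/-!
# Resampling one link of the product Haar measure on the torus (gauge-boot, task L3(ξ), 1/5)

HONEST FRAMING (cell `pub-gaugeboot`, page 1 of every file): the venture produces certified bounds
on lattice expectations at stated coupling, gauge group, dimension and torus size; NOT a mass gap,
NOT a continuum limit, NOT a string tension; NOT Yang–Mills-summit-bearing (barriers
`FixedCouplingUltralocality`, `PerturbativeInvisibility`). This module is measure-theoretic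
plumbing for the structural NEGATIVE result `DiagonalRPTorusNegativeOddSUN` (closed-half diagonal
RP fails on odd three-tori for `G ≅ SU(N)` at small coupling); it discharges nothing by itself.

## Content (any finite index type, any compact group `G`)

* `map_update_pi_prod` — resampling one coordinate of a finite product of copies of a probability
  measure from an independent copy preserves the product:
  `(μ^{⊗ι} ⊗ μ) ∘ ((U, s) ↦ U[e ↦ s])⁻¹ = μ^{⊗ι}`;
* `integral_pi_update` — the disintegration `∫ F dμ^{⊗ι} = ∫ (∫ F(U[e ↦ s]) dμ(s)) dμ^{⊗ι}(U)`
  for integrable `F` (Fubini along one coordinate);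
* `integral_pi_update_of_forall` — the working form: if `∫ F(U[e ↦ s]) dμ(s) = H(U)` for every
  `U`, then `∫ F = ∫ H`;
* `measurePreserving_update_mul_left` / `integral_update_mul_left` — multiplying ONE link
  variable on the left by a fixed group element preserves the product Haar measure of a compact
  group (`haarProbability`, left invariance), hence every integral.

Folklore measure theory (Fubini for finite products; invariance of Haar measure); written out
because Mathlib's `lmarginal` API is `ℝ≥0∞`-valued. No definition, no named fact.
-/

open MeasureTheory Finset Function

namespace Summit.QuantumFields.GaugeBoot

open Literature.MathematicalPhysics.QuantumFieldTheory

noncomputable section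

namespace DiagRPSUN

/-! ## Resampling one coordinate of a finite product of probability measures -/

section Update

variable {ι : Type*} [Fintype ι] [DecidableEq ι] {X : Type*} [MeasurableSpace X]
  (μ : Measure X) [IsProbabilityMeasure μ]

/-- **Resampling one coordinate preserves the product**: the image of `μ^{⊗ι} ⊗ μ` under
`(U, s) ↦ U[e ↦ s]` is `μ^{⊗ι}` (checked on measurable boxes, `Measure.pi_eq`). -/
theorem map_update_pi_prod (e : ι) :
    ((Measure.pi fun _ : ι => μ).prod μ).map (fun p : (ι → X) × X => update p.1 e p.2) =
      Measure.pi fun _ : ι => μ := by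
  symm
  refine Measure.pi_eq fun A hA => ?_
  rw [Measure.map_apply measurable_update' (MeasurableSet.univ_pi hA)]
  have hpre : (fun p : (ι → X) × X => update p.1 e p.2) ⁻¹' Set.pi Set.univ A =
      (Set.pi Set.univ (update A e Set.univ)) ×ˢ A e := by
    ext ⟨z, s⟩
    simp only [Set.mem_preimage, Set.mem_univ_pi, Set.mem_prod]
    constructor
    · intro h
      refine ⟨fun i => ?_, by simpa using h e⟩
      by_cases hi : i = e
      · subst hi; simp
      · rw [update_of_ne hi]
        simpa [update_of_ne hi] using h i
    · rintro ⟨h1, h2⟩ i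
      by_cases hi : i = e
      · subst hi; simpa using h2
      · rw [update_of_ne hi]
        simpa [update_of_ne hi] using h1 i
  rw [hpre, Measure.prod_prod, Measure.pi_pi]
  have hfun : (fun i => μ (update A e Set.univ i)) = update (fun i => μ (A i)) e (μ Set.univ) := by
    funext i
    by_cases hi : i = e
    · subst hi; simp
    · simp [update_of_ne hi]
  rw [show (∏ i, μ (update A e Set.univ i)) = ∏ i, (fun i => μ (update A e Set.univ i)) i
      from rfl, hfun, prod_update_of_mem (mem_univ e), measure_univ, one_mul,
    sdiff_singleton_eq_erase, prod_erase_mul _ _ (mem_univ e)]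

/-- **Fubini along one coordinate**: for `F` integrable against `μ^{⊗ι}`,
`∫ F dμ^{⊗ι} = ∫ (∫ F(U[e ↦ s]) dμ(s)) dμ^{⊗ι}(U)`. -/
theorem integral_pi_update (e : ι) {E : Type*} [NormedAddCommGroup E] [NormedSpace ℝ E]
    {F : (ι → X) → E} (hF : Integrable F (Measure.pi fun _ : ι => μ)) :
    ∫ U, F U ∂Measure.pi (fun _ : ι => μ) =
      ∫ U, (∫ s, F (update U e s) ∂μ) ∂Measure.pi (fun _ : ι => μ) := by
  set π := Measure.pi fun _ : ι => μ with hπ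
  have hmeas : Measurable (fun p : (ι → X) × X => update p.1 e p.2) := measurable_update'
  have hmap := map_update_pi_prod μ e
  have hFm : AEStronglyMeasurable F ((π.prod μ).map fun p : (ι → X) × X => update p.1 e p.2) := by
    rw [hmap]; exact hF.aestronglyMeasurable
  have hint : Integrable (fun p : (ι → X) × X => F (update p.1 e p.2)) (π.prod μ) :=
    (integrable_map_measure hFm hmeas.aemeasurable).1 (by rw [hmap]; exact hF)
  calc ∫ U, F U ∂π = ∫ U, F U ∂((π.prod μ).map fun p : (ι → X) × X => update p.1 e p.2) := by
        rw [hmap]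
    _ = ∫ p, F (update p.1 e p.2) ∂(π.prod μ) := integral_map hmeas.aemeasurable hFm
    _ = ∫ U, ∫ s, F (update U e s) ∂μ ∂π := integral_prod _ hint

/-- **Resampling, working form**: if the one-coordinate average of `F` at `e` is `H`, pointwise,
then `∫ F = ∫ H`. -/
theorem integral_pi_update_of_forall (e : ι) {E : Type*} [NormedAddCommGroup E] [NormedSpace ℝ E]
    {F H : (ι → X) → E} (hF : Integrable F (Measure.pi fun _ : ι => μ))
    (h : ∀ U, ∫ s, F (update U e s) ∂μ = H U) :
    ∫ U, F U ∂Measure.pi (fun _ : ι => μ) = ∫ U, H U ∂Measure.pi (fun _ : ι => μ) := by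
  rw [integral_pi_update μ e hF]
  exact integral_congr_ae (ae_of_all _ h)

end Update

/-! ## Twisting one link variable of the product Haar measure -/

section Twist

variable {ι : Type*} [Fintype ι] [DecidableEq ι] {G : Type*} [Group G] [TopologicalSpace G]
  [IsTopologicalGroup G] [CompactSpace G] [MeasurableSpace G] [BorelSpace G]

omit [Fintype ι] [TopologicalSpace G] [IsTopologicalGroup G] [CompactSpace G] [MeasurableSpace G]
  [BorelSpace G] in
/-- Left multiplication of the single coordinate `e` by `z`, as a coordinatewise map. -/
theorem update_mul_eq (e : ι) (z : G) (U : ι → G) :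
    update U e (z * U e) = fun i => (if i = e then (fun g : G => z * g) else id) (U i) := by
  funext i
  by_cases hi : i = e
  · subst hi; simp
  · simp [hi]

/-- **Twisting one link preserves product Haar measure**: `U ↦ U[e ↦ z · U(e)]` preserves
`∏ dU` (left invariance of the Haar probability measure of the compact group `G` in the
coordinate `e`, identity elsewhere; `measurePreserving_pi`). -/
theorem measurePreserving_update_mul_left (e : ι) (z : G) :
    MeasurePreserving (fun U : ι → G => update U e (z * U e))
      (Measure.pi fun _ : ι => haarProbability G) (Measure.pi fun _ : ι => haarProbability G) := by
  have heq : (fun U : ι → G => update U e (z * U e)) =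
      fun U i => (if i = e then (fun g : G => z * g) else id) (U i) :=
    funext fun U => update_mul_eq e z U
  rw [heq]
  refine measurePreserving_pi _ _ fun i => ?_
  split_ifs
  · exact measurePreserving_mul_left (haarProbability G) z
  · exact MeasurePreserving.id _

/-- **Twist invariance of integrals**: `∫ F(U[e ↦ z · U(e)]) ∏ dU = ∫ F ∏ dU` for measurable
complex `F`. -/
theorem integral_update_mul_left (e : ι) (z : G) {F : (ι → G) → ℂ} (hF : Measurable F) :
    ∫ U, F (update U e (z * U e)) ∂Measure.pi (fun _ : ι => haarProbability G) =
      ∫ U, F U ∂Measure.pi (fun _ : ι => haarProbability G) := by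
  have hT := measurePreserving_update_mul_left (G := G) e z
  rw [← integral_map hT.measurable.aemeasurable hF.aestronglyMeasurable, hT.map_eq]

end Twist

end DiagRPSUN

end

end Summit.QuantumFields.GaugeBoot
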